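import Mathlib
import Literature.RingTheory.HopfAlgebra.FiniteDualBaseChange
import Literature.RingTheory.HopfAlgebra.FiniteDualHopfAlgebra
import Literature.AlgebraicGeometry.Motives.TannakianDistributionsBaseChange
import HarnessLib

/-!
# The dual bialgebra commutes with base change: `S ⊗_R B^* ≃ (S ⊗_R B)^*` as bialgebras — `(G^D)_S = (G_S)^D`
(Tate, *Finite flat group schemes* (in Cornell–Silverman–Stevens 1997), §(3.8) «The dual Hopf algebra and Cartier duality»,
p. 145: «for an `R`-algebra `B`, `(A_B)′ = A′_B`» — as Hopf algebras; Milne, *Algebraic Groups*, Ch. 10 §d 10.19)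

Topic `RingTheory/HopfAlgebra`; namespace `Literature.RingTheory.HopfAlgebra`.  THEOREMS ONLY (no definition, no instance, no
notation, no named fact, no `sorry`).  Cell `pub/hodgecm-mathlib` (D-0151), FLOOR 0, programme F0P5a (crux item
stmt-HodgeConjecture-24832; PLAN v4.1 ∕ MOD-ROAD-P″ add2 KF8 «duality row», H-CD piece CD2-bcc = the COALGEBRA half of the base
change of the Cartier dual); road- and floor-independent commutative algebra; changes no count.

SETTING.  `R → S` commutative rings, `B` a commutative `R`-bialgebra, finite and free as an `R`-module; `W := WithConv (Module.Dual R B)`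
its dual, with the dual bialgebra structure `FiniteDual.bialgebra R B` of ★ `FiniteDualHopfAlgebra` (reducible definition installed by
`letI` INSIDE the statements), so that Mathlib's `TensorProduct.instBialgebra` makes `S ⊗[R] W` a bialgebra over `S`; and
`(S ⊗_R B)^* := WithConv (Module.Dual S (S ⊗[R] B))` with `FiniteDual.bialgebra S (S ⊗[R] B)`.  ★ `FiniteDualBaseChange` gave the
`S`-ALGEBRA isomorphism `e₀ : S ⊗_R B^* ≃ₐ[S] (S ⊗_R B)^*`, `e₀ (s ⊗ μ) = s • μ_S` (`exists_algEquiv_dualBaseChange`, `μ_S =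
Tannakian.dualBaseChange S μ = Module.Dual.baseChange S μ`).  This file proves that `e₀` is also a COALGEBRA map for the dual
coalgebras, DEF-FREE: every statement about the map takes an `S`-linear `e` with `he : e (s ⊗ μ) = s • μ_S` as hypotheses.

* §1 evaluations of base-changed forms: `dual_baseChange_apply_tmul_mul_tmul` (`μ_S ((t ⊗ b)(t' ⊗ b')) = μ(b b') • (t t')`),
  `dual_baseChange_apply_one` (`μ_S 1 = μ 1`), `smul_dualBaseChange_apply` (`(s • μ_S) z = s * μ_S z`),
  `dualCounit_smul_dualBaseChange` (`ε_{(S ⊗ B)^*} (s • μ_S) = μ 1 • s`).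
* §2 counits: `counit_tmul_dual` (`ε_{S ⊗ W} (s ⊗ μ) = μ 1 • s`), **`counit_comp_eq_of_tmul`** (`ε ∘ e = ε` for any `e` with `he`).
* §3 comultiplications: `sum_dual_baseChange_mul_eq` (for `Δ_W μ = Σ μ₁ ⊗ μ₂`: `Σ (μ₁)_S z · (μ₂)_S z' = μ_S (z z')` — both sides
  `S`-bilinear, equal on `t ⊗ b`, `t' ⊗ b'` by ★ F3 `FiniteDual.evalTwo_comul` over `R`), `evalTwo_map_comul_tmul`
  (`evalTwo_S ((e ⊗ e)(Δ_{S ⊗ W}(s ⊗ μ))) (z ⊗ z') = s · μ_S (z z')`, through ★ `Tannakian.comul_baseChange_tmul`),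
  `evalTwo_dualComul_smul_dualBaseChange` (`evalTwo_S (Δ_{(S ⊗ B)^*} (s • μ_S)) (z ⊗ z') = s · μ_S (z z')`),
  **`map_comp_comul_eq_of_tmul`** (`(e ⊗ e) ∘ Δ = Δ ∘ e`, by ★ CD1-thm `eq_of_evalTwo_eq` over `S`).
* §4 HEAD **`exists_bialgEquiv_dualBaseChange`**: `∃ e : S ⊗[R] W ≃ₐc[S] (S ⊗_R B)^*, ∀ s μ, e (s ⊗ μ) = s • μ_S` — `(G^D)_S ≅ (G_S)^D`
  as bialgebras on the algebra side (existence ⇒ no definition; `e` pinned on pure tensors).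

NOT here: the antipode clause (for a commutative COCOMMUTATIVE Hopf algebra both sides are Hopf and a bialgebra iso between Hopf
algebras commutes with the antipodes; Mathlib has no Hopf-morphism type — left to the consumer), points (★ `FiniteDualPoints`,
`FiniteDualGroupLikePoints`), the bidual (★ `FiniteDualBidual`).

HC_CM is proved only modulo the 7 printed citations until rung 0 closes; this file is generic algebra and changes no count.

## References
* [Tate1997FiniteFlatGroupSchemes] J. Tate, *Finite flat group schemes*, in: Modular Forms and Fermat's Last Theorem (1997), §(3.8)
  p. 145 (`(A_B)′ = A′_B`).
* [Milne2017] J. S. Milne, *Algebraic Groups*, CUP (2017), Ch. 10 §d 10.19 (`μ ↦ μ_S`).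
-/

set_option autoImplicit false

noncomputable section

open TensorProduct WithConv
open Literature.AlgebraicGeometry.Motives

namespace Literature.RingTheory.HopfAlgebra

universe u v w

variable {R : Type u} [CommRing R] (S : Type w) [CommRing S] [Algebra R S]
variable {B : Type v} [CommRing B] [Bialgebra R B]

/-! ## §1 Evaluating base-changed forms -/

section Eval

/-- `μ_S ((t ⊗ b)(t' ⊗ b')) = μ(b b') • (t t')`. [cite: Milne2017, Ch. 10 §d 10.19] -/
theorem dual_baseChange_apply_tmul_mul_tmul (μ : Module.Dual R B) (t t' : S) (b b' : B) :
    Module.Dual.baseChange S μ ((t ⊗ₜ[R] b) * (t' ⊗ₜ[R] b')) = μ (b * b') • (t * t') := by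
  rw [Algebra.TensorProduct.tmul_mul_tmul, Module.Dual.baseChange_apply_tmul]

/-- `μ_S 1 = μ 1` (in `S`). [cite: Milne2017, Ch. 10 §d 10.19] -/
theorem dual_baseChange_apply_one (μ : Module.Dual R B) :
    Module.Dual.baseChange S μ (1 : S ⊗[R] B) = algebraMap R S (μ 1) := by
  rw [Algebra.TensorProduct.one_def, Module.Dual.baseChange_apply_tmul, Algebra.algebraMap_eq_smul_one]

/-- `(s • μ_S) z = s * μ_S z` for the base change `Tannakian.dualBaseChange S μ` read as a form on `S ⊗ B`.
[cite: Milne2017, Ch. 10 §d 10.19] -/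
theorem smul_dualBaseChange_apply (s : S) (μ : WithConv (Module.Dual R B)) (z : S ⊗[R] B) :
    (s • Tannakian.dualBaseChange (R := R) S μ) z = s * Module.Dual.baseChange S μ.ofConv z := by
  rw [ofConv_smul, LinearMap.smul_apply, Tannakian.dualBaseChange_apply_ofConv, smul_eq_mul]

/-- `ε_{(S ⊗ B)^*} (s • μ_S) = μ(1) • s` for the dual counit `f ↦ f 1` of `(S ⊗_R B)^*`. [cite: Tate1997FiniteFlatGroupSchemes, §(3.8) p. 145] -/
theorem dualCounit_smul_dualBaseChange (s : S) (μ : WithConv (Module.Dual R B)) :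
    FiniteDual.counit S (S ⊗[R] B) (s • Tannakian.dualBaseChange (R := R) S μ) = μ 1 • s := by
  rw [FiniteDual.counit_apply, smul_dualBaseChange_apply, dual_baseChange_apply_one, Algebra.smul_def, mul_comm]

end Eval

/-! ## §2 The counits -/

section Counit

variable [Module.Free R B] [Module.Finite R B]

/-- `ε_{S ⊗ W} (s ⊗ μ) = μ(1) • s` for Mathlib's base-change coalgebra of the dual coalgebra `W = B^*` (`ε_W μ = μ 1`).
[cite: Tate1997FiniteFlatGroupSchemes, §(3.8) p. 145] -/
theorem counit_tmul_dual (s : S) (μ : WithConv (Module.Dual R B)) :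
    letI : Bialgebra R (WithConv (Module.Dual R B)) := FiniteDual.bialgebra R B
    Coalgebra.counit (R := S) (s ⊗ₜ[R] μ : S ⊗[R] WithConv (Module.Dual R B)) = μ 1 • s := by
  letI : Bialgebra R (WithConv (Module.Dual R B)) := FiniteDual.bialgebra R B
  rw [Tannakian.counit_baseChange_tmul]
  rfl

/-- **`ε_{(S ⊗ B)^*} ∘ e = ε_{S ⊗ W}`** for any `S`-linear `e : S ⊗_R W → (S ⊗_R B)^*` with `e (s ⊗ μ) = s • μ_S`.
[cite: Tate1997FiniteFlatGroupSchemes, §(3.8) p. 145] -/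
theorem counit_comp_eq_of_tmul :
    letI : Bialgebra R (WithConv (Module.Dual R B)) := FiniteDual.bialgebra R B
    letI : Bialgebra S (WithConv (Module.Dual S (S ⊗[R] B))) := FiniteDual.bialgebra S (S ⊗[R] B)
    ∀ (e : S ⊗[R] WithConv (Module.Dual R B) →ₗ[S] WithConv (Module.Dual S (S ⊗[R] B)))
      (_he : ∀ (s : S) (μ : WithConv (Module.Dual R B)), e (s ⊗ₜ μ) = s • Tannakian.dualBaseChange (R := R) S μ),
      Coalgebra.counit ∘ₗ e = Coalgebra.counit := by
  letI : Bialgebra R (WithConv (Module.Dual R B)) := FiniteDual.bialgebra R B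
  letI : Bialgebra S (WithConv (Module.Dual S (S ⊗[R] B))) := FiniteDual.bialgebra S (S ⊗[R] B)
  intro e he
  refine TensorProduct.AlgebraTensorModule.ext fun s μ => ?_
  rw [LinearMap.comp_apply, he, counit_tmul_dual]
  exact dualCounit_smul_dualBaseChange S s μ

end Counit

/-! ## §3 The comultiplications -/

section Comul

variable [Module.Free R B] [Module.Finite R B]

/-- For a representation `Δ_W μ = Σ μ₁ ⊗ μ₂` of the dual comultiplication: **`Σ (μ₁)_S(z) · (μ₂)_S(z') = μ_S(z z')`** for all
`z, z' ∈ S ⊗_R B` (both sides are `S`-bilinear; on `t ⊗ b`, `t' ⊗ b'` both are `t t' · μ(b b')` by `FiniteDual.evalTwo_comul`).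
[cite: Tate1997FiniteFlatGroupSchemes, §(3.8) p. 145] -/
theorem sum_dual_baseChange_mul_eq (μ : WithConv (Module.Dual R B)) {ι : Type*} :
    letI : Bialgebra R (WithConv (Module.Dual R B)) := FiniteDual.bialgebra R B
    ∀ (𝓡 : Coalgebra.Repr R μ ι) (z z' : S ⊗[R] B),
      ∑ i ∈ 𝓡.index, Module.Dual.baseChange S (𝓡.left i).ofConv z * Module.Dual.baseChange S (𝓡.right i).ofConv z' =
        Module.Dual.baseChange S μ.ofConv (z * z') := by
  letI : Bialgebra R (WithConv (Module.Dual R B)) := FiniteDual.bialgebra R B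
  intro 𝓡 z z'
  -- the pure-tensor case, from `evalTwo (Δ μ) (b ⊗ b') = μ (b b')` over `R`
  have key : ∀ b b' : B, ∑ i ∈ 𝓡.index, (𝓡.left i) b * (𝓡.right i) b' = μ (b * b') := by
    intro b b'
    have h : FiniteDual.evalTwo R B (Coalgebra.comul μ) (b ⊗ₜ b') = μ (b * b') :=
      FiniteDual.evalTwo_comul (R := R) (B := B) μ b b'
    rw [← 𝓡.eq, map_sum, LinearMap.sum_apply] at h
    simpa only [FiniteDual.evalTwo_tmul] using h
  induction z using TensorProduct.induction_on with
  | zero => simp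
  | add x y hx hy =>
    simp only [map_add, add_mul, Finset.sum_add_distrib, hx, hy]
  | tmul t b =>
    induction z' using TensorProduct.induction_on with
    | zero => simp
    | add x y hx hy =>
      simp only [map_add, mul_add, Finset.sum_add_distrib, hx, hy]
    | tmul t' b' =>
      simp only [Module.Dual.baseChange_apply_tmul, Algebra.TensorProduct.tmul_mul_tmul, smul_mul_smul_comm,
        ← Finset.sum_smul]
      rw [key]

/-- `evalTwo_S ((e ⊗ e)(Δ_{S ⊗ W}(s ⊗ μ))) (z ⊗ z') = s · μ_S (z z')`: the comultiplication of Mathlib's base change `S ⊗_R W`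
of the dual coalgebra, pushed along `e ⊗ e` and paired with `z ⊗ z'` (`Δ_S(s ⊗ μ) = Σ (1 ⊗ μ₁) ⊗ (s ⊗ μ₂)`,
`Tannakian.comul_baseChange_tmul`). [cite: Tate1997FiniteFlatGroupSchemes, §(3.8) p. 145] -/
theorem evalTwo_map_comul_tmul :
    letI : Bialgebra R (WithConv (Module.Dual R B)) := FiniteDual.bialgebra R B
    ∀ (e : S ⊗[R] WithConv (Module.Dual R B) →ₗ[S] WithConv (Module.Dual S (S ⊗[R] B)))
      (_he : ∀ (s : S) (μ : WithConv (Module.Dual R B)), e (s ⊗ₜ μ) = s • Tannakian.dualBaseChange (R := R) S μ)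
      (s : S) (μ : WithConv (Module.Dual R B)) (z z' : S ⊗[R] B),
      FiniteDual.evalTwo S (S ⊗[R] B)
          (TensorProduct.map e e (Coalgebra.comul (R := S) (s ⊗ₜ[R] μ : S ⊗[R] WithConv (Module.Dual R B)))) (z ⊗ₜ z') =
        s * Module.Dual.baseChange S μ.ofConv (z * z') := by
  letI : Bialgebra R (WithConv (Module.Dual R B)) := FiniteDual.bialgebra R B
  intro e he s μ z z'
  let 𝓡 := Coalgebra.Repr.arbitrary R μ
  rw [Tannakian.comul_baseChange_tmul S s 𝓡, map_sum, map_sum, LinearMap.sum_apply]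
  simp only [TensorProduct.map_tmul, he, one_smul, FiniteDual.evalTwo_tmul]
  have h := sum_dual_baseChange_mul_eq S μ 𝓡 z z'
  calc ∑ i ∈ 𝓡.index, (Tannakian.dualBaseChange (R := R) S (𝓡.left i)) z *
          (s • Tannakian.dualBaseChange (R := R) S (𝓡.right i)) z'
        = s * ∑ i ∈ 𝓡.index, Module.Dual.baseChange S (𝓡.left i).ofConv z *
            Module.Dual.baseChange S (𝓡.right i).ofConv z' := by
          rw [Finset.mul_sum]
          refine Finset.sum_congr rfl fun i _ => ?_
          rw [smul_dualBaseChange_apply]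
          change Module.Dual.baseChange S (𝓡.left i).ofConv z * _ = _
          ring
    _ = s * Module.Dual.baseChange S μ.ofConv (z * z') := by rw [h]

/-- `evalTwo_S (Δ_{(S ⊗ B)^*} (s • μ_S)) (z ⊗ z') = s · μ_S (z z')` (the dual comultiplication is the transpose of the product).
[cite: Tate1997FiniteFlatGroupSchemes, §(3.8) p. 145] -/
theorem evalTwo_dualComul_smul_dualBaseChange (s : S) (μ : WithConv (Module.Dual R B)) (z z' : S ⊗[R] B) :
    FiniteDual.evalTwo S (S ⊗[R] B) (FiniteDual.comul S (S ⊗[R] B) (s • Tannakian.dualBaseChange (R := R) S μ)) (z ⊗ₜ z') =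
      s * Module.Dual.baseChange S μ.ofConv (z * z') := by
  rw [FiniteDual.evalTwo_comul]
  exact smul_dualBaseChange_apply S s μ (z * z')

/-- **`(e ⊗ e) ∘ Δ_{S ⊗ W} = Δ_{(S ⊗ B)^*} ∘ e`** for any `S`-linear `e` with `e (s ⊗ μ) = s • μ_S`: the base-change map is compatible
with the dual comultiplications (both sides pair with every `z ⊗ z'` to `s · μ_S(z z')`, and `evalTwo_S` is injective —
★ CD1-thm `eq_of_evalTwo_eq` over `S`). [cite: Tate1997FiniteFlatGroupSchemes, §(3.8) p. 145] -/
theorem map_comp_comul_eq_of_tmul :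
    letI : Bialgebra R (WithConv (Module.Dual R B)) := FiniteDual.bialgebra R B
    letI : Bialgebra S (WithConv (Module.Dual S (S ⊗[R] B))) := FiniteDual.bialgebra S (S ⊗[R] B)
    ∀ (e : S ⊗[R] WithConv (Module.Dual R B) →ₗ[S] WithConv (Module.Dual S (S ⊗[R] B)))
      (_he : ∀ (s : S) (μ : WithConv (Module.Dual R B)), e (s ⊗ₜ μ) = s • Tannakian.dualBaseChange (R := R) S μ),
      TensorProduct.map e e ∘ₗ Coalgebra.comul = Coalgebra.comul ∘ₗ e := by
  letI : Bialgebra R (WithConv (Module.Dual R B)) := FiniteDual.bialgebra R B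
  letI : Bialgebra S (WithConv (Module.Dual S (S ⊗[R] B))) := FiniteDual.bialgebra S (S ⊗[R] B)
  intro e he
  refine LinearMap.ext fun x => ?_
  induction x using TensorProduct.induction_on with
  | zero => simp only [map_zero]
  | add x y hx hy => simp only [map_add, hx, hy]
  | tmul s μ =>
    refine eq_of_evalTwo_eq (ev := FiniteDual.evalTwo S (S ⊗[R] B)) FiniteDual.evalTwo_tmul fun z z' => ?_
    rw [LinearMap.comp_apply, LinearMap.comp_apply, evalTwo_map_comul_tmul S e he, he]
    exact (evalTwo_dualComul_smul_dualBaseChange S s μ z z').symm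

end Comul

/-! ## §4 `S ⊗_R B^* ≃ (S ⊗_R B)^*` as bialgebras -/

section Bialg

/-- **`(G^D)_S ≅ (G_S)^D` AS BIALGEBRAS** (Tate: «`(A_B)′ = A′_B`»): for a commutative bialgebra `B` finite free over `R` and any
commutative `R`-algebra `S`, with the dual bialgebra structures of ★ `FiniteDualHopfAlgebra` on `W = B^*` (base-changed to `S` by
Mathlib) and on `(S ⊗_R B)^*`, there is a bialgebra isomorphism over `S`, `e : S ⊗_R W ≃ₐc[S] (S ⊗_R B)^*`, with
`e (s ⊗ μ) = s • μ_S` — the `S`-algebra isomorphism of ★ `exists_algEquiv_dualBaseChange`, which §2–§3 show to be a coalgebra map.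
Stated as an existence so that no definition is introduced; `e` is pinned on pure tensors. [cite: Tate1997FiniteFlatGroupSchemes, §(3.8) p. 145] -/
theorem exists_bialgEquiv_dualBaseChange [Module.Free R B] [Module.Finite R B] :
    letI : Bialgebra R (WithConv (Module.Dual R B)) := FiniteDual.bialgebra R B
    letI : Bialgebra S (WithConv (Module.Dual S (S ⊗[R] B))) := FiniteDual.bialgebra S (S ⊗[R] B)
    ∃ e : S ⊗[R] WithConv (Module.Dual R B) ≃ₐc[S] WithConv (Module.Dual S (S ⊗[R] B)),
      ∀ (s : S) (μ : WithConv (Module.Dual R B)), e (s ⊗ₜ μ) = s • Tannakian.dualBaseChange (R := R) S μ := by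
  letI : Bialgebra R (WithConv (Module.Dual R B)) := FiniteDual.bialgebra R B
  letI : Bialgebra S (WithConv (Module.Dual S (S ⊗[R] B))) := FiniteDual.bialgebra S (S ⊗[R] B)
  obtain ⟨e₀, he₀⟩ := exists_algEquiv_dualBaseChange (R := R) S (B := B)
  refine ⟨{ toFun := e₀,
             invFun := e₀.symm,
             left_inv := e₀.left_inv,
             right_inv := e₀.right_inv,
             map_add' := e₀.map_add,
             map_smul' := fun s x => map_smul e₀ s x,
             map_mul' := e₀.map_mul,
             counit_comp := counit_comp_eq_of_tmul S _ (fun s μ => he₀ s μ),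
             map_comp_comul := map_comp_comul_eq_of_tmul S _ (fun s μ => he₀ s μ) }, fun s μ => he₀ s μ⟩

end Bialg

end Literature.RingTheory.HopfAlgebra
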